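import Summits.QuantumFields.GaugeBoot.Certificates.SparseReducedWindowE
import HarnessLib

/-!
# Reduced problem family `KZL2rpD4LIM`, second tier for the «LIMIT ∣ cap» files: the two CAPPED difference-Hankel blocks ×`q` (P-A5 STAGE 3, S3b)

Cell `ym-instrument` (HOME `run/shared/lean/pub/ym-instrument/`), crew (a), seat `ym-instrument-boot-lean-1` (gen 4); planner work order P-A5 STAGE 3
«LIMIT ∣ cap kernel replay» (boot-plan 2026-08-27T14:33:09Z; LEAD A-0826-82). The three R0 «LIMIT ∣ cap» certificate files of record
(`certs/a/files/SU2-D4/kzL2rpLIMcap/SU2_D4_b9o5_kzL2rphkhdcap_LIM_lin-chi22-{c3o2,c2}_lower.problem1.json`, `SU2_D4_b11o5_…-c3o2_lower.problem1.json`)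
carry 75 PSD blocks: blocks `0–72` are blocks `0–72` of the uncapped class-LIMIT family `KZL2rpD4LIM` (70 reduced blocks of record + `hankel-site/R1/S0-2`,
`hankel-site/R2/S0-1`, `hankel-link/R1/S0-1`), and blocks `73`, `74` are the CAPPED difference-Hankel blocks `hdcap/R1/D0cap{0..1}` (entries
`ρ y₀ − y₁, ρ y₁ − y₂, ρ y₂ − y₅`) and `hdcap/R1/D1cap{0..1}` (`ρ y₁ − y₂, ρ y₂ − y₅, ρ y₅ − y₂₇`) with the RATIONAL `ρ = p/q` (`2177/2500` at `β_std = 9/5`,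
`558/625` at `11/5`). The weighted two-tier kernel `Sparse.objective_boundW_of_le` (`SparseReducedWindowBoundW`) takes them as a SECOND TIER of integer
blocks scaled by `q` (PSD-invariant): entries `p y₀ − q y₁, …`; this module is that tier's FAMILY TABLE, parametric in `(p, q)`, with the three
family-level checks (`dimCheck`, `rowLenCheck` at the common padding `48`, `sortedCheck`) decided for the two instances of record. Data only, `[folklore]`.

HONEST FRAMING (cells `pub-gaugeboot` / `ym-instrument`): certified bounds on lattice expectations at stated coupling, gauge group, dimension; class LIMIT =
limit points of even-side torus states, NOT a finite-torus bound; NOT a mass gap, NOT a continuum limit, NOT a string tension; nothing summit-bearing.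
This module certifies nothing by itself; the blocks' positivity at limit points is `YangMills/Theorems/Instrument/LimitCapBlocksKZL2rpLIM.lean`.
-/

namespace Summit.QuantumFields.GaugeBoot.Certificates.KZL2rpD4LIMCap

noncomputable section

open Summit.QuantumFields.GaugeBoot.Certificates.Sparse

/-- **Second-tier entry tables of the «LIMIT ∣ cap» files**: the two capped difference-Hankel blocks scaled by `q` — block `0` = `q · hdcap/R1/D0cap{0..1}`
(upper entries `(0,0) = p y₀ − q y₁`, `(0,1) = p y₁ − q y₂`, `(1,1) = p y₂ − q y₅`), block `1` = `q · hdcap/R1/D1cap{0..1}` (`p y₁ − q y₂`, `p y₂ − q y₅`,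
`p y₅ − q y₂₇`); wincore layout block ↦ rows `i` ↦ upper entries `j − i` ↦ sorted `(v, c)`. [folklore] -/
def EB (p q : ℕ) : List (List (List (List (ℕ × ℤ)))) :=
  [[[[(0, (p : ℤ)), (1, -(q : ℤ))], [(1, (p : ℤ)), (2, -(q : ℤ))]], [[(2, (p : ℤ)), (5, -(q : ℤ))]]],
   [[[(1, (p : ℤ)), (2, -(q : ℤ))], [(2, (p : ℤ)), (5, -(q : ℤ))]], [[(5, (p : ℤ)), (27, -(q : ℤ))]]]]

/-- Dimensions of the two second-tier blocks. [folklore] -/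
def dimL : List ℕ := [2, 2]

/-- Dimension check of the second tier at `ρ = 2177/2500` (`β_std = 9/5`), padded size `48`. [folklore] -/
theorem dim_chk_b9o5 : dimCheck (EB 2177 2500) dimL 48 2 = true := by
  decide +kernel

/-- Row-length check of the second tier at `ρ = 2177/2500`. [folklore] -/
theorem row_len_b9o5 : rowLenCheck (EB 2177 2500) 48 2 = true := by
  decide +kernel

/-- Sortedness check of the second tier at `ρ = 2177/2500`. [folklore] -/
theorem sorted_chk_b9o5 : sortedCheck (EB 2177 2500) = true := by
  decide +kernel

/-- Dimension check of the second tier at `ρ = 558/625` (`β_std = 11/5`), padded size `48`. [folklore] -/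
theorem dim_chk_b11o5 : dimCheck (EB 558 625) dimL 48 2 = true := by
  decide +kernel

/-- Row-length check of the second tier at `ρ = 558/625`. [folklore] -/
theorem row_len_b11o5 : rowLenCheck (EB 558 625) 48 2 = true := by
  decide +kernel

/-- Sortedness check of the second tier at `ρ = 558/625`. [folklore] -/
theorem sorted_chk_b11o5 : sortedCheck (EB 558 625) = true := by
  decide +kernel

/-- Both blocks have dimension `2`. [folklore] -/
theorem dimL_getD (t : Fin 2) : dimL.getD t.val 0 = 2 := by
  match t with
  | ⟨0, _⟩ => rfl
  | ⟨1, _⟩ => rfl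

end

end Summit.QuantumFields.GaugeBoot.Certificates.KZL2rpD4LIMCap
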